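import Summits.BirchSwinnertonDyer.BirchSwinnertonDyer.Theorems.ThetaPartnerAtTwoSignedKatoUpToAtTwoHeckeBaseCasesAtTwo
import Summits.BirchSwinnertonDyer.BirchSwinnertonDyer.Theorems.ThetaPartnerAtTwoSignedKatoUpToAtTwoPlusHondaLogBaseCases
import Summits.BirchSwinnertonDyer.BirchSwinnertonDyer.Theorems.ThetaPartnerAtTwoSignedKatoUpToAtTwoKatoTrivialCharValues
import Literature.NumberTheory.EllipticCurves.LFunctionPrimeCoeff
import HarnessLib

/-!
# Route `ThetaPartnerAtTwo` (TP2), crux K3 `SignedKatoDivisibilityUpToAtTwo` (stmt-BirchSwinnertonDyer-20308 / K3P′ 25631), line `colemanrat`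
# v13 — the kernel bricks B4a (Hecke at `2`), B4b (base-case logarithms), B4c (trivial-character Kato values) IN THE LEAD'S SOCKET SHAPE,
# discharged BY NAME from the width seats' theorems (w3 g7 `HeckeBase.*`, w4 g0 `LocalVar.*_level_zero/_one_level_one`, `KatoValue.sum_sigma_eq_of_zetaBody`)

Lead prover `bsd-wall-tp2-p2x` g7 (cell `bsd-wall`). HONEST FRAMING: theorems only; adapters (casts, `if n = 0`, the Euler factor `3/2` at `a₂ = 0`);
these are exactly the stubs `stub_heckeBaseTwo`, `stub_logBaseTwo`, `stub_katoTrivialValuesTwo` of skeleton v13; closes no item; K3 / K3P′ NOT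
settled; BSD is NOT proved by any of this.
-/

set_option autoImplicit false
-- the Theorems namespace of this sub repeats the summit name by design (D-0017 nested layout)
set_option linter.dupNamespace false

noncomputable section

set_option backward.isDefEq.respectTransparency false

open scoped Classical MatrixGroups ModularForm NumberField TensorProduct

open CongruenceSubgroup WeierstrassCurve Field IsDedekindDomain NumberField
  Literature.NumberTheory.GaloisRepresentations
  Literature.NumberTheory.EllipticCurves Literature.NumberTheory.EllipticCurves.ModularForms
  Literature.NumberTheory.EllipticCurves.Module Literature.NumberTheory.EllipticCurves.Rank1Residual
  Literature.NumberTheory.EllipticCurves.Kobayashi2003 Literature.NumberTheory.EllipticCurves.Kato2004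
  Literature.NumberTheory.EllipticCurves.Kato2004.EulerSystemValues Literature.NumberTheory.EllipticCurves.GreenbergSelmer
  Literature.NumberTheory.EllipticCurves.Sprung2012
  Literature.NumberTheory.EllipticCurves.FormalGroupChart
  ZpExtension Summit.BirchSwinnertonDyer.Rank1Residual.Supersingular
  Summit.BirchSwinnertonDyer.Rank1Residual.Additive Summit.BirchSwinnertonDyer.Rank1Residual.Additive.PadicCyclotomicTower
  Summit.BirchSwinnertonDyer.Rank1Residual.Additive.BallEval
  Summit.BirchSwinnertonDyer.BirchSwinnertonDyer.Theorems.SignedKatoOffTwo.LocalTwo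

namespace Summit.BirchSwinnertonDyer.BirchSwinnertonDyer.Theorems.SignedKatoOffTwo.KatoBK

/-- **Brick B4a (Hecke at `2` for the trivial character) in the socket shape** (w3 g7's `HeckeBase.ratTwistedSymbolSum_one_level_two_eq_neg` /
`…_three_eq_four_mul`). [cite: MazurTateTeitelbaum1986Invent, §I.4] -/
theorem heckeBaseTwo_brick :
    ∀ {N : ℕ} [NeZero N] (f : CuspForm (Gamma0 N) 2), IsNewform0 f → coeffField f = ⊥ → ¬ 2 ∣ N →
    cuspCoeff f 2 = 0 →
    ratTwistedSymbolSum f (1 : DirichletCharacter ℂ_[2] (2 ^ (0 + 2))) = ((-(ratPlusSymbol f 0) : ℚ) : ℂ_[2]) ∧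
    ratTwistedSymbolSum f (1 : DirichletCharacter ℂ_[2] (2 ^ (1 + 2))) = ((4 * ratPlusSymbol f 0 : ℚ) : ℂ_[2]) := by
  intro N _ f hf hQ h2N ha
  refine ⟨?_, ?_⟩
  · rw [HeckeBase.ratTwistedSymbolSum_one_level_two_eq_neg ℂ_[2] hf hQ h2N ha (0 + 2) rfl]
    push_cast; ring
  · rw [HeckeBase.ratTwistedSymbolSum_one_level_three_eq_four_mul ℂ_[2] hf hQ h2N ha (1 + 2) rfl]
    push_cast; ring

/-- **Brick B4b (base-case logarithms of the displayed plus Honda points) in the socket shape** (w4 g0's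
`LocalVar.sum_pow_mul_ptLogΩ_pow_smul_plusHondaPoint_eq_level_zero` / `…_eq_one_level_one`). [cite: Kobayashi2003, §8.4, Prop. 8.26] -/
theorem logBaseTwo_brick :
    ∀ (W : WeierstrassCurve ℚ) [W.IsElliptic] [W.IsGloballyMinimal]
    {c : ℕ → localPoints W ℚ_[2]} {σ : ℕ → Field.absoluteGaloisGroup ℚ_[2]} {d : ℕ → localPoints W ℚ_[2]},
    (haveI := isIntegral_genFib_baseChange 2 ((integralModelInt W).map (Int.castRingHom ℤ_[2]))
      ∀ m, (toLoc ((genFibΩ_eq_baseChange ((integralModelInt W).map (Int.castRingHom ℤ_[2]))).trans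
            (baseChange_twoAdicModel W))).symm (c m) ∈
          subfieldPoints (genFibΩ 2 ((integralModelInt W).map (Int.castRingHom ℤ_[2]))) (layer 2 m).toSubfield
            coeffs_mem_layer ∧
        (toLoc ((genFibΩ_eq_baseChange ((integralModelInt W).map (Int.castRingHom ℤ_[2]))).trans
            (baseChange_twoAdicModel W))).symm (c m) ∈
          kernel (Valued.v (R := PadicAlgCl 2)) (genFibΩ 2 ((integralModelInt W).map (Int.castRingHom ℤ_[2]))) ∧
        ptLogΩ 2 ((integralModelInt W).map (Int.castRingHom ℤ_[2]))
          ((toLoc ((genFibΩ_eq_baseChange ((integralModelInt W).map (Int.castRingHom ℤ_[2]))).trans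
            (baseChange_twoAdicModel W))).symm (c m)) = ell 2 m) →
    (∀ m, 1 ≤ m → σ m • zeta 2 m = (zeta 2 m)⁻¹) →
    (∀ n, d n = 3 • (c (n + 2) + σ (n + 2) • c (n + 2)) - 2 • c 1) →
    ∀ (n : ℕ), n ≤ 1 → ∀ {g₀ : Field.absoluteGaloisGroup ℚ_[2]}, g₀ • zeta 2 (n + 2) = zeta 2 (n + 2) ^ 5 →
    haveI := isIntegral_genFib_baseChange 2 ((integralModelInt W).map (Int.castRingHom ℤ_[2]))
    ∑ j ∈ Finset.range (2 ^ n), ptLogΩ 2 ((integralModelInt W).map (Int.castRingHom ℤ_[2]))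
        ((toLoc ((genFibΩ_eq_baseChange ((integralModelInt W).map (Int.castRingHom ℤ_[2]))).trans
          (baseChange_twoAdicModel W))).symm (g₀ ^ j • d n)) =
      ((if n = 0 then (-2 : ℚ) else 8 : ℚ) : PadicAlgCl 2) := by
  intro W _ _ c σ d hcΩ hσ hd n hn g₀ hg₀
  interval_cases n
  · have h := LocalVar.sum_pow_mul_ptLogΩ_pow_smul_plusHondaPoint_eq_level_zero W hcΩ hσ hd g₀
      (1 : DirichletCharacter (PadicAlgCl 2) (2 ^ (0 + 2)))
    have h5 : (1 : DirichletCharacter (PadicAlgCl 2) (2 ^ (0 + 2))) (5 : ZMod (2 ^ (0 + 2))) = 1 :=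
      MulChar.one_apply (by rw [show (5 : ZMod (2 ^ (0 + 2))) = 1 from by decide]; exact isUnit_one)
    simp only [h5, one_pow, one_mul] at h
    rw [h]; push_cast; simp
  · have h := LocalVar.sum_pow_mul_ptLogΩ_pow_smul_plusHondaPoint_eq_one_level_one W hcΩ hσ hd hg₀
    have h5 : (1 : DirichletCharacter (PadicAlgCl 2) (2 ^ (1 + 2))) (5 : ZMod (2 ^ (1 + 2))) = 1 :=
      MulChar.one_apply (by decide)
    simp only [h5, one_pow, one_mul] at h
    rw [h]; push_cast; simp

/-- **Brick B4c (Kato's trivial-character values at levels `4, 8`) in the socket shape** (w4 g0's `KatoValue.sum_sigma_eq_of_zetaBody` with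
`eulerFactorAtOne W N 2 = 3/2` from `a₂(W) = 0`, `2 ∤ N`). [cite: Kato2004Asterisque, Thm. 6.6 (1), Thm. 9.7] -/
theorem katoTrivialValuesTwo_brick :
    ∀ (W : WeierstrassCurve ℚ) [W.IsElliptic] [W.IsGloballyMinimal], GoodSS W 2 → W.frobeniusTrace 2 = 0 →
    ∀ [NeZero (W.conductorNorm ℤ)] (f : CuspForm (Gamma0 (W.conductorNorm ℤ)) 2), IsNewformOf W f →
    ∀ [ContinuousSMul ℤ_[2] (W.tateModule 2)] [Module.Free ℤ_[2] (W.tateModule 2)] [Module.Finite ℤ_[2] (W.tateModule 2)]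
    {ιC : (m : ℕ) → (CyclotomicField m ℚ →+* ℂ)} {κK : ℝ}
    {ΛK : ∀ (k : ℕ) (r : Finset (HeightOneSpectrum (𝓞 ℚ))),
      H1 (tateRep W 2) (cycSubgroup 2 k r) →ₗ[ℤ_[2]] ℚ_[2] ⊗[ℚ] CyclotomicField (cycLevel 2 k r) ℚ}
    {c d a : ℤ} {A : ℕ}
    {z : ∀ (k : ℕ) (r : (cyclotomicLevelsRat 2 (badPlaces c d A (W.conductorNorm ℤ))).Ideals),
      H1 (tateRep W 2) ((cyclotomicLevelsRat 2 (badPlaces c d A (W.conductorNorm ℤ))).level k r.1)}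
    {x : ∀ (k : ℕ) (r : (cyclotomicLevelsRat 2 (badPlaces c d A (W.conductorNorm ℤ))).Ideals),
      CyclotomicField (cycLevel 2 k r.1) ℚ},
    ZetaBody W 2 f ιC κK ΛK c d a A z x → ∀ {q : ℚ}, κK = q → ∀ {ee : ℕ}, A = 2 ^ ee → ∀ (d' : ℤ), d * d' ≡ 1 [ZMOD (A : ℤ)] →
    ∀ (k : ℕ), 2 ≤ k → k ≤ 3 → Int.gcd (c * d) (cycLevel 2 k (∅ : Finset (HeightOneSpectrum (𝓞 ℚ))) * A) = 1 →
    ∑ b : (ZMod (cycLevel 2 k (∅ : Finset (HeightOneSpectrum (𝓞 ℚ)))))ˣ,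
        sigma (cycLevel 2 k (∅ : Finset (HeightOneSpectrum (𝓞 ℚ)))) b
          (x k (cyclotomicLevelsRat 2 (badPlaces c d A (W.conductorNorm ℤ))).idealOne) =
      ((3 / 2 * q * ratPlusSymbol f 0 *
          (c ^ 2 * d ^ 2 * ratMinusSymbol f ((a : ℚ) / A) - c * d ^ 2 * ratMinusSymbol f ((a * c : ℚ) / A)
            - c ^ 2 * d * ratMinusSymbol f ((a * d' : ℚ) / A) + c * d * ratMinusSymbol f ((a * c * d' : ℚ) / A)) : ℚ) :
        CyclotomicField (cycLevel 2 k (∅ : Finset (HeightOneSpectrum (𝓞 ℚ)))) ℚ) := by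
  intro W _ _ hss ha _ f hf _ _ _ ιC κK ΛK c d a A z x hbody q hq ee hA d' hdd' k hk2 hk3 hcd
  have hN2 : ¬ 2 ∣ W.conductorNorm ℤ := not_dvd_level_of_isNewformOf hf hss.1
  have hL2 : W.LFunction 2 = 0 := by rw [LFunction_apply_prime_eq_frobeniusTrace W 2 hss.1, ha]
  have h := KatoValue.sum_sigma_eq_of_zetaBody hf 2 hbody hq (by omega : 1 ≤ k) hA d' hcd hdd'
  rw [h, KatoValue.eulerFactorAtOne_two_eq hL2 hN2, eq_ratCast, ratCuspFactor]
  congr 1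
  simp only [↓reduceIte, hA]
  push_cast
  ring

end Summit.BirchSwinnertonDyer.BirchSwinnertonDyer.Theorems.SignedKatoOffTwo.KatoBK

end
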